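import Summits.QuantumAdvantage.QuantumAdvantage.Theses.WhiteBoxWalk
import Literature.Computability.QuantumComplexity.SinkOfVerifiableLine
import Literature.Computability.QuantumComplexity.QueryHybridBound
import Literature.Computability.QuantumComplexity.ExactQuantumQuery

/-!
# Line `transposition-coupling-reduction` for crux `WhiteBoxWalk.WbwVerifiableLineNoSpeedup`
# (stmt-QuantumAdvantage-2239) — planner's CHECKED skeleton (crux-plan, round 1, 2026-08-16)

Crux (by `Negative.crux_iff`, `Iff.rfl`):
`∃ c > 0, ∀ m T, 2 ≤ m → 1 ≤ T → T + 1 ≤ 2^(m-1) → c · min (T+1) √(2^m) / m ≤ Q_{1/3}(svlPromise m T, svlSinkBit m T)`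
(bit queries to the `2^m·m + 2^m·(T+1)` table bits of `(S, V)`; `N := 2^m` below).

THE LINE (idea card `Ideas/transposition-coupling-reduction.md`, triage r1-1/2/3: pass as the
assembly shell whose non-elementary stubs are the engine shared with `mergefree-line-recording`).
Hard distribution `J′ = mergeFreeSet m T` (random injective line through `0ᵐ`, every successor value
of an off-line name or of the sink is OFF the line). MOVING HORIZON: the horizon run of an algorithm
answers query round `r` (0-based) with the input `horizonInput (r+2) t` in which every `V`-cell of
level `> r+2` reads `false` (`horizonState`, a time-dependent run `stateAtSched`). Then
* real run vs horizon run (BBBV telescoping with the horizon run as reference): the inputs differ at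
  round `r` exactly on the MARKED hidden cells `(x_i, i)`, `i ≥ r+3`, whose query mass is a
  PAIR-GUESSING probability — `stub_pairGuessing` (K2);
* the horizon run is blind to the parity of the sink: the SINK-FLIP RELABELLING `τ = (x_T, x_T ⊕ 1)`
  is a measure-preserving involution of the sub-family `J″ ⊆ J′` ("`x_T ⊕ 1` off-line and without
  `S`-preimage", `|J′| ≤ 64 |J″|`) flipping the sink bit and changing the horizon inputs only inside
  the three `S`-rows `x_{T-1}, x_T, x_T ⊕ 1` — `stub_sinkFlipCoupling` (K4) — whose query mass is a
  NAME-GUESSING probability for a deep level — `stub_deepGuessing` (K1, the hardest stub);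
* `stub_horizonAssembly` (K3): K1 → K2 → K4 → no algorithm with `q + 3 ≤ T`, `q ≤ c₁ √N` queries
  computes the sink bit with error `1/3` on `J′` (constants: `1/3 ≤ (64 √K₂ + 96 √K₁) q/√N`);
* `WbwVerifiableLineNoSpeedup_of` (kernel-checked, no sorry of its own): the optimal algorithm
  (`exists_queries_eq_quantumQueryComplexityOn`) restricted to `J′ ⊆ svlPromise` gives
  `Q ≥ T - 2 ∨ Q > c₁ √N`; with `Q ≥ 1` (§1, = Disproof §3) the crux follows with `c = min c₁ (1/4)`
  and WITHOUT using the `1/m` (the line proves the name-query-strength mutation, Disproof §6.6).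

DISPROOF USED (`Cruxes/WbwVerifiableLineNoSpeedup/Disproof.lean`, cdisprove gen 1 cycle 1, RESISTS; its
landed part `Theorems/WbwVerifiableLineNoSpeedup/Negative/LoadBearing.lean` is restated in §1, not
imported — the farm snapshot does not serve that module yet):
`wbwVerifiableLineNoSpeedup_false_without_Tpos` — honoured: `1 ≤ T` is used in `_of` (via
`one_le_svlQ_of_hyps`) and in K4 (`1 ≤ T`: the sink must differ from the source);
`…_false_without_Tbound` — honoured: `T + 1 ≤ 2^(m-1)` is used as `2(T+1) ≤ 2^m` (`|OFF| ≥ N/2`) in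
K1/K2/K4; `not_groverBranchOnly` — respected: the bound proved is `min(T-2, c₁√N)`, both branches;
`admissible_const_le_one` — `c = min c₁ (1/4) ≤ 1/4`; Disproof §6.3 (elementary truncation hybrid
reaches only `min(T, √(N/(T+1))/34)`) — this line's horizon is MOVING and its leak terms are
guessing probabilities, not `(T-j)/N` masses; no stub is an instance of a landed Negative lemma
(LoadBearing.lean contains only the two load-bearing refutations and zero-query facts).

DEFINITION MIRRORS (§0; definition requests filed, see the line card):
`mergeFreeSet`, `flipLow`, `horizonInput`, `stateAtSched`, `horizonState`. They are ordinary data /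
predicate definitions over tree vocabulary; once landed in `Literature/Computability/QuantumComplexity`
under the same short names the lead deletes §0 and the stub signatures are textually unchanged.

§1 (`Q ≥ 1` under the hypotheses) is copied verbatim (sorry-free) from LoadBearing.lean /
Disproof.lean §3 so that this file imports only modules the farm serves.
-/

noncomputable section

set_option linter.dupNamespace false

namespace Summit.QuantumAdvantage.QuantumAdvantage.Cruxes.WbwVerifiableLineNoSpeedup.TranspositionCouplingReduction

open Matrix Finset
open Literature.Computability.Cryptography Literature.Computability.QuantumComplexity
  Literature.Computability.Complexity
open Summit.QuantumAdvantage.QuantumAdvantage.Theses.WhiteBoxWalk (WbwVerifiableLineNoSpeedup)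

open scoped Classical

/-! ## §0 Definition mirrors (the objects of the line) -/

section Defs

variable {m T : ℕ}

/-- The finite set `J′ = mergeFreeSet m T` of MERGE-FREE SVL inputs: `t = (S, V)` has a verifiable
line `xs` (so `t ∈ svlPromise m T`) AND the successor of every name that is off the line or is the
sink lies OFF the line (the line vertices `x₁, …, x_T` have in-degree exactly one, from their
predecessor; off-line walks never enter the line). The hard distribution of the card is the uniform
distribution on this set (uniform injective line through `0ᵐ`, i.i.d. uniform off-line junk). -/
def mergeFreeSet (m T : ℕ) : Finset (SVLInput m T) :=
  Finset.univ.filter fun t => ∃ xs : Fin (T + 1) → Fin (2 ^ m), IsSvlLine t xs ∧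
    ∀ y : Fin (2 ^ m), (∀ i : Fin T, y ≠ xs i.castSucc) → ∀ i : Fin (T + 1), svlSucc t y ≠ xs i

/-- Membership in `mergeFreeSet`. -/
theorem mem_mergeFreeSet {t : SVLInput m T} :
    t ∈ mergeFreeSet m T ↔ ∃ xs : Fin (T + 1) → Fin (2 ^ m), IsSvlLine t xs ∧
      ∀ y : Fin (2 ^ m), (∀ i : Fin T, y ≠ xs i.castSucc) → ∀ i : Fin (T + 1), svlSucc t y ≠ xs i := by
  simp [mergeFreeSet]

/-- `J′ ⊆ svlPromise`. -/
theorem mergeFreeSet_subset_svlPromise :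
    (↑(mergeFreeSet m T) : Set (SVLInput m T)) ⊆ svlPromise m T := by
  intro t ht
  obtain ⟨xs, hxs⟩ := mem_mergeFreeSet.1 (Finset.mem_coe.1 ht)
  exact ⟨xs, hxs.1⟩

/-- Flip the low-order bit of a name: `x ↦ x ⊕ 1` (the partner of the sink in the sink-flip
coupling; `% 2^m` is a no-op for `m ≥ 1` and a harmless junk value for `m = 0`). -/
def flipLow (x : Fin (2 ^ m)) : Fin (2 ^ m) :=
  ⟨(x.val ^^^ 1) % 2 ^ m, Nat.mod_lt _ (Nat.two_pow_pos m)⟩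

/-- The HORIZON-TRUNCATED input: `horizonInput h t` agrees with `t` on the whole `S`-table and on
the `V`-cells of level `≤ h`, and reads `false` on every `V`-cell `(x, i)` with `i > h`. -/
def horizonInput (h : ℕ) (t : SVLInput m T) : SVLInput m T := fun k =>
  if ∃ x : Fin (2 ^ m), ∃ i : Fin (T + 1), k = svlVerifyIndex m T x i ∧ h < i.val then false
  else t k

variable {N : ℕ}

/-- The run of a query algorithm against a TIME-DEPENDENT oracle: round `r` (0-based) queries the
input `x r` (BBBV 1997, Thm 3.3 in its original generality; `stateAtSched A (fun _ => x) = stateAt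
A x`, `stateAtSched_const`). -/
def stateAtSched (A : QQueryAlg N) (x : ℕ → (Fin N → Bool)) : ℕ → (Fin N × Bool × A.W → ℂ)
  | 0 => unitaryAt A 0 *ᵥ Pi.single A.start 1
  | s + 1 => unitaryAt A (s + 1) *ᵥ (queryOracle (x s) *ᵥ stateAtSched A x s)

/-- With a constant schedule the time-dependent run is the tree's `stateAt`. -/
theorem stateAtSched_const (A : QQueryAlg N) (x : Fin N → Bool) (s : ℕ) :
    stateAtSched A (fun _ => x) s = stateAt A x s := by
  induction s with
  | zero => rfl
  | succ s ih => simp only [stateAtSched, stateAt, ih]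

/-- The HORIZON RUN of `A` on `t`: query round `r` is answered by `horizonInput (r + 2) t` (only
`V`-marks of level `≤ r + 2` are visible at round `r`); `horizonState A t s` is the state after `s`
rounds. -/
def horizonState (A : QQueryAlg (2 ^ m * m + 2 ^ m * (T + 1))) (t : SVLInput m T) (s : ℕ) :
    Fin (2 ^ m * m + 2 ^ m * (T + 1)) × Bool × A.W → ℂ :=
  stateAtSched A (fun r => horizonInput (r + 2) t) s

end Defs

/-! ## §1 Support: `Q ≥ 1` under the crux's hypotheses (verbatim from Negative/LoadBearing.lean §0–§2 and Disproof.lean §3, sorry-free)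

`Theorems/WbwVerifiableLineNoSpeedup/Negative/LoadBearing.lean` is not yet built on the farm snapshot
(lean check: `remote:stale:unbuilt`), so its few lemmas used here are restated instead of imported;
the lead may swap this section for the import once the module is served. -/

section Support

variable {m T : ℕ}

/-- The quantity bounded by the crux (= `Negative.svlQ`, `Disproof.svlQ`). -/
abbrev svlQ (m T : ℕ) : ℕ := quantumQueryComplexityOn (1 / 3) (svlPromise m T) (svlSinkBit m T)

/-- The crux is, by `Iff.rfl`, the statement over `svlPromise` / `svlSinkBit` (= `Negative.crux_iff`). -/
theorem crux_iff :
    WbwVerifiableLineNoSpeedup ↔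
      ∃ c : ℝ, 0 < c ∧ ∀ m T : ℕ, 2 ≤ m → 1 ≤ T → T + 1 ≤ 2 ^ (m - 1) →
        c * min ((T : ℝ) + 1) (Real.sqrt (2 ^ m)) / m ≤ (svlQ m T : ℝ) :=
  Iff.rfl

/-- `2 ≤ m` is implied by the other two hypotheses (= `Negative.two_le_of_hyps`). -/
theorem two_le_of_hyps (hT : 1 ≤ T) (hTm : T + 1 ≤ 2 ^ (m - 1)) : 2 ≤ m := by
  rcases Nat.lt_or_ge m 2 with hm | hm
  · interval_cases m <;> simp at hTm <;> omega
  · exact hm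

/-- Room for a sink of either parity: `T + 2 ≤ 2^m` (= `Negative.succ_succ_le_two_pow_of_hyps`). -/
theorem succ_succ_le_two_pow_of_hyps (hT : 1 ≤ T) (hTm : T + 1 ≤ 2 ^ (m - 1)) :
    T + 2 ≤ 2 ^ m := by
  have hm := two_le_of_hyps hT hTm
  have h2 : 2 ^ m = 2 * 2 ^ (m - 1) := by
    rw [← Nat.pow_succ']
    congr 1
    omega
  have h1 : 1 ≤ 2 ^ (m - 1) := Nat.one_le_two_pow
  omega

/-- The input length is positive (= `Negative.inputLen_pos`). -/
theorem inputLen_pos (m T : ℕ) : 0 < 2 ^ m * m + 2 ^ m * (T + 1) :=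
  Nat.add_pos_right _ (Nat.mul_pos (Nat.two_pow_pos m) (Nat.succ_pos T))

/-- `NeZero` instance for the SVL input length (= `Negative.instNeZeroSvlLen`). -/
instance instNeZeroSvlLen' (m T : ℕ) : NeZero (2 ^ m * m + 2 ^ m * (T + 1)) :=
  ⟨(inputLen_pos m T).ne'⟩

/-- A zero-query algorithm has an input-independent final state (= `Negative.finalState_eq_of_queries_eq_zero`). -/
theorem finalState_eq_of_queries_eq_zero {N : ℕ} (A : QQueryAlg N) (h : A.queries = 0)
    (x y : Fin N → Bool) : A.finalState x = A.finalState y := by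
  cases A with
  | mk W q U s acc =>
    simp only at h
    subst h
    simp [QQueryAlg.finalState]

/-- … hence an input-independent acceptance probability (= `Negative.acceptProb_eq_of_queries_eq_zero`). -/
theorem acceptProb_eq_of_queries_eq_zero {N : ℕ} (A : QQueryAlg N) (h : A.queries = 0)
    (x y : Fin N → Bool) : A.acceptProb x = A.acceptProb y := by
  unfold QQueryAlg.acceptProb
  rw [finalState_eq_of_queries_eq_zero A h x y]

/-- If `f` takes both values on `D` then `1 ≤ Q_{1/3}(D, f)`
(= `Negative.one_le_quantumQueryComplexityOn_of_nonconst`). -/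
theorem one_le_quantumQueryComplexityOn_of_nonconst {N : ℕ} [NeZero N] {D : Set (Fin N → Bool)}
    {f : (Fin N → Bool) → Bool} {x₀ x₁ : Fin N → Bool} (hx₀ : x₀ ∈ D) (hx₁ : x₁ ∈ D)
    (hf₀ : f x₀ = false) (hf₁ : f x₁ = true) : 1 ≤ quantumQueryComplexityOn (1 / 3) D f := by
  by_contra hlt
  push Not at hlt
  have h0 : quantumQueryComplexityOn (1 / 3) D f = 0 := Nat.lt_one_iff.1 hlt
  obtain ⟨A, hAq, hA⟩ :=
    exists_queries_eq_quantumQueryComplexityOn (by norm_num : (0 : ℝ) ≤ 1 / 3) D f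
  rw [h0] at hAq
  have h1 := (hA x₁ hx₁).1 hf₁
  have h2 := (hA x₀ hx₀).2 hf₀
  rw [acceptProb_eq_of_queries_eq_zero A hAq x₁ x₀] at h1
  linarith

/-- The successor table of the line `xs`: `S(xs i) = xs (i+1)` for `i < T`, identity elsewhere. -/
def lineSucc (xs : Fin (T + 1) → Fin (2 ^ m)) (x : Fin (2 ^ m)) : Fin (2 ^ m) :=
  if h : ∃ i : Fin T, xs i.castSucc = x then xs (Classical.choose h).succ else x

/-- The input `(S, V)` of the line `xs`. -/
def lineInput (xs : Fin (T + 1) → Fin (2 ^ m)) : SVLInput m T :=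
  svlInput m T (lineSucc xs) fun x i => decide (x = xs i)

/-- For an injective `xs` with `xs 0 = 0`, `lineInput xs` is in the promise set with line `xs`. -/
theorem isSvlLine_lineInput {xs : Fin (T + 1) → Fin (2 ^ m)}
    (hinj : Function.Injective xs) (h0 : (xs 0).val = 0) : IsSvlLine (lineInput xs) xs := by
  rw [isSvlLine_iff]
  refine ⟨hinj, h0, fun i => ?_, fun x i => ?_⟩
  · rw [lineInput, svlSucc_svlInput, lineSucc]
    have hex : ∃ i' : Fin T, xs i'.castSucc = xs i.castSucc := ⟨i, rfl⟩
    rw [dif_pos hex]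
    have hi : Classical.choose hex = i := by
      have := Classical.choose_spec hex
      exact Fin.castSucc_injective _ (hinj this)
    rw [hi]
  · rw [lineInput, svlVerify_svlInput]

/-- Hence `lineInput xs ∈ svlPromise m T`. -/
theorem lineInput_mem {xs : Fin (T + 1) → Fin (2 ^ m)}
    (hinj : Function.Injective xs) (h0 : (xs 0).val = 0) : lineInput xs ∈ svlPromise m T :=
  ⟨xs, isSvlLine_lineInput hinj h0⟩

/-- And its sink bit is the parity of `xs T`. -/
theorem svlSinkBit_lineInput {xs : Fin (T + 1) → Fin (2 ^ m)}
    (hinj : Function.Injective xs) (h0 : (xs 0).val = 0) :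
    svlSinkBit m T (lineInput xs) = decide ((xs (Fin.last T)).val % 2 = 1) :=
  (isSvlLine_lineInput hinj h0).svlSinkBit_eq

/-- The bent line `0, 1, …, T-1, T+1` (requires `T + 2 ≤ 2^m`). -/
def bentLine (h : T + 2 ≤ 2 ^ m) (i : Fin (T + 1)) : Fin (2 ^ m) :=
  if i = Fin.last T then ⟨T + 1, by omega⟩ else ⟨i.val, by omega⟩

theorem bentLine_injective (h : T + 2 ≤ 2 ^ m) : Function.Injective (bentLine h) := by
  intro i j hij
  unfold bentLine at hij
  by_cases hi : i = Fin.last T <;> by_cases hj : j = Fin.last T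
  · rw [hi, hj]
  · rw [if_pos hi, if_neg hj] at hij
    have := Fin.mk.inj_iff.1 hij
    have hj' := j.isLt
    omega
  · rw [if_neg hi, if_pos hj] at hij
    have := Fin.mk.inj_iff.1 hij
    have hi' := i.isLt
    omega
  · rw [if_neg hi, if_neg hj] at hij
    exact Fin.ext (Fin.mk.inj_iff.1 hij)

theorem bentLine_zero (h : T + 2 ≤ 2 ^ m) (hT : 1 ≤ T) : (bentLine h 0).val = 0 := by
  have h0 : (0 : Fin (T + 1)) ≠ Fin.last T := by
    intro h0
    have := congrArg Fin.val h0
    simp at this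
    omega
  simp [bentLine, h0]

theorem bentLine_last (h : T + 2 ≤ 2 ^ m) : (bentLine h (Fin.last T)).val = T + 1 := by
  simp [bentLine]

/-- **`Q ≥ 1` pointwise.** For `1 ≤ T` and `T + 2 ≤ 2^m` the sink bit takes both values on the
promise (straight line ends at `T`, bent line at `T + 1`), so no zero-query algorithm computes it. -/
theorem one_le_svlQ (hT : 1 ≤ T) (h : T + 2 ≤ 2 ^ m) : 1 ≤ svlQ m T := by
  have hs : T + 1 ≤ 2 ^ m := (Nat.le_succ _).trans h
  have hA := lineInput_mem (m := m) (xs := svlStraightLine hs)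
    (fun i j hij => Fin.ext (Fin.mk.inj_iff.1 hij)) rfl
  have hAbit := svlSinkBit_lineInput (m := m) (xs := svlStraightLine hs)
    (fun i j hij => Fin.ext (Fin.mk.inj_iff.1 hij)) rfl
  have hB := lineInput_mem (bentLine_injective h) (bentLine_zero h hT)
  have hBbit := svlSinkBit_lineInput (bentLine_injective h) (bentLine_zero h hT)
  rw [bentLine_last] at hBbit
  have hlastA : (svlStraightLine hs (Fin.last T)).val = T := rfl
  rw [hlastA] at hAbit
  rcases Nat.even_or_odd T with hev | hodd
  · rw [Nat.even_iff] at hev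
    refine one_le_quantumQueryComplexityOn_of_nonconst hA hB ?_ ?_
    · rw [hAbit, decide_eq_false_iff_not]
      omega
    · rw [hBbit, decide_eq_true_iff]
      omega
  · rw [Nat.odd_iff] at hodd
    refine one_le_quantumQueryComplexityOn_of_nonconst hB hA ?_ ?_
    · rw [hBbit, decide_eq_false_iff_not]
      omega
    · rw [hAbit, decide_eq_true_iff]
      omega

/-- `Q ≥ 1` under the crux's literal hypotheses. -/
theorem one_le_svlQ_of_hyps (hT : 1 ≤ T) (hTm : T + 1 ≤ 2 ^ (m - 1)) : 1 ≤ svlQ m T :=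
  one_le_svlQ hT (succ_succ_le_two_pow_of_hyps hT hTm)

end Support

/-! ## §2 The stubs (K1, K2, K4, K3) -/

/-- **K1 — `stub_deepGuessing`: the SHARP DEEP-GUESSING LEMMA (hardest stub; the engine).**
There are absolute `K, c₀ > 0` such that for all `m, T, j` with `2(T+1) ≤ 2^m` (the line fills at
most half of the names), every algorithm `A` with `q = A.queries ≤ c₀ √(2^m)` bit-queries, run in the
HORIZON MODEL (round `r` sees `V` only up to level `r + 2`), and every way `out` of reading a name off
the measured final basis state, guesses the level-`j` vertex `x_j`, `j ≥ q + 3`, with `J′`-average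
probability `≤ K / 2^m`:
`(1/|J′|) Σ_{t ∈ J′} Σ_b [out b = x_j(t)] · |⟨b | horizonState A t q⟩|² ≤ K / 2^m`.
Why plausibly true: a vertex of level `≥ q+3` can neither be reached by walking (one level per
query) nor be VERIFIED (its `V`-cells are beyond the horizon at every round), and under `J′` its only
`S`-visible signature is in-degree `1` without off-line preimages, testable only by inverting `S`
(`≈ √N` queries per constant likelihood factor); classically the posterior of `x_j` given everything
seen is uniform over `≥ 2^m - T - q - 1 ≥ 2^m/4` candidates (`K ≈ 4`); `q = 0`: `1/(2^m - 1)`.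
Why it might fail / what it needs: NOT provable by hybrid / coupling / norm transfer (floor `q²/2^m`,
card NOTES F4–F5, triage r1-2); needs a transcript (recording / compressed-oracle) formalism for the
NON-product distribution `J′` with `V`-tests (Rosmanis 2021 arXiv:2103.08975 §3, inversion only;
Majenz–Malavolta–Walter 2025 Thm 1.1, cubic; Chung–Fehr–Huang–Liao 2021 p.9, functions) or a dual
(adversary) certificate — shared with card `mergefree-line-recording`'s K1. Size: XL (research-level).
Leans on: `QueryHybridBound.stateAt/unitaryAt`, `SinkOfVerifiableLine.*`; §0 mirrors. -/
theorem stub_deepGuessing :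
    ∃ K c₀ : ℝ, 0 < K ∧ 0 < c₀ ∧
      ∀ (m T j : ℕ) (hj : j ≤ T) (A : QQueryAlg (2 ^ m * m + 2 ^ m * (T + 1)))
        (out : Fin (2 ^ m * m + 2 ^ m * (T + 1)) × Bool × A.W → Fin (2 ^ m)),
        2 * (T + 1) ≤ 2 ^ m → A.queries + 3 ≤ j → (A.queries : ℝ) ≤ c₀ * Real.sqrt (2 ^ m) →
        (∑ t ∈ mergeFreeSet m T, ∑ b : Fin (2 ^ m * m + 2 ^ m * (T + 1)) × Bool × A.W,
            if ∃ xs : Fin (T + 1) → Fin (2 ^ m), IsSvlLine t xs ∧ out b = xs ⟨j, Nat.lt_succ_of_le hj⟩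
            then ‖horizonState A t A.queries b‖ ^ 2 else 0) /
          ((mergeFreeSet m T).card : ℝ) ≤ K / 2 ^ m := by
  sorry

/-- **K2 — `stub_pairGuessing`: the PAIR-GUESSING LEMMA (bounds the real-vs-horizon leak).**
Absolute `K, c₀ > 0` such that for `2(T+1) ≤ 2^m` and every horizon-model algorithm `A` with
`q = A.queries ≤ c₀ √(2^m)` and every reading `out` of a (name, level) PAIR off the final basis
state, the `J′`-average probability that the pair is a correct DEEP mark — level `i ≥ q + 3` and
name `= x_i(t)` — is `≤ K / 2^m`. (In K3 this is applied to the truncations `A_r` of the real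
algorithm with `out b =` "the `V`-cell addressed by the query register of `b`": the expected query
mass of `horizonState A t r` on the hidden marked cells `(x_i, i)`, `i ≥ r+3`, which are exactly the
positions where `t` and `horizonInput (r+2) t` differ.)
Why plausibly true: as K1 — a hidden level cannot be verified, pins inside the horizon advance one
level per query and never cross it (pin at level `≤ r'+2` at round `r'` ⇒ `≤ r+2` at round `r`), so
a deep hit is a blind guess of a (name, level) pair: posterior `≤ 1/(2^m - T - q) ≤ 4/2^m`.
Why it might fail / what it needs: the elementary transfer K1 ⇒ K2 through the SUFFIX-ROTATION
coupling (which makes the level of a deep held name uniform) only certifies `K·q²` (card NOTES F5);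
K2 must be proved INSIDE the formalism proving K1, with the rotation as its symmetry. Size: L (given
K1's formalism). Leans on: as K1; BennettBernsteinBrassardVazirani1997 Thm 3.3. -/
theorem stub_pairGuessing :
    ∃ K c₀ : ℝ, 0 < K ∧ 0 < c₀ ∧
      ∀ (m T : ℕ) (A : QQueryAlg (2 ^ m * m + 2 ^ m * (T + 1)))
        (out : Fin (2 ^ m * m + 2 ^ m * (T + 1)) × Bool × A.W → Fin (2 ^ m) × Fin (T + 1)),
        2 * (T + 1) ≤ 2 ^ m → (A.queries : ℝ) ≤ c₀ * Real.sqrt (2 ^ m) →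
        (∑ t ∈ mergeFreeSet m T, ∑ b : Fin (2 ^ m * m + 2 ^ m * (T + 1)) × Bool × A.W,
            if A.queries + 3 ≤ ((out b).2 : ℕ) ∧
                ∃ xs : Fin (T + 1) → Fin (2 ^ m), IsSvlLine t xs ∧ (out b).1 = xs (out b).2
            then ‖horizonState A t A.queries b‖ ^ 2 else 0) /
          ((mergeFreeSet m T).card : ℝ) ≤ K / 2 ^ m := by
  sorry

/-- **K4 — `stub_sinkFlipCoupling`: the SINK-FLIP RELABELLING COUPLING (pure combinatorics).**
For `1 ≤ T` and `2(T+1) ≤ 2^m` there are a nonempty sub-family `J ⊆ J′` with `|J′| ≤ 64 |J|` and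
an involution `φ` of `J` that FLIPS the sink bit and changes the horizon-truncated inputs
`horizonInput h ·` (`h < T`) only at `S`-bit positions of the three rows `x_T`, `x_{T-1}`,
`x_T ⊕ 1` (`flipLow`).
Intended witness: `J = J″ := {t ∈ J′ : x_T ⊕ 1 is off the line and has no S-preimage}`,
`φ t := relabel t by the transposition τ = (x_T, x_T ⊕ 1)` (`S ↦ τ S τ`, `V(y,i) ↦ V(τ y, i)`):
`τ` fixes `0ᵐ` (so the promise is preserved, line `↦ τ ∘ line`, Sketch `relabel_mem_svlPromise`),
maps `J″` to `J″`, new sink `x_T ⊕ 1` has the opposite parity; `S`-rows change only at `x_{T-1}`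
(bit 0), `x_T`, `x_T ⊕ 1` (contents swapped; no other row points to `x_T` or `x_T ⊕ 1` in `J″`), and
`V` changes only at level `T > h`, which `horizonInput h` blanks on both sides. Counting:
`#{lines with x_T ⊕ 1 off-line} / #{lines} = (N-T-1)/(N-1) ≥ 1/2` and
`P[no junk value hits x_T ⊕ 1] = (1 - 1/M)^{M+1} ≥ 1/8` (`M = N-T-1 ≥ 2`), so `|J′| ≤ 16 |J″|`.
Nonempty: line `x_i = 2i`, all free rows `↦ 1`. (Triage r1-2/r1-3 sharpenings — Poisson preimage
set of `x_T ⊕ 1`, exclusion of `x_T ⊕ 1 ∈ {x_0, …, x_{q+2}}` — are both discharged by `J″`.)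
Why it might fail: only by a slip in the difference-set bookkeeping (bit positions of a row =
`svlSuccIndex m T x ·`); the statement leaves `J`, `φ` and the constant `64` free. Size: M.
Leans on: `svlInput`, `svlInput_mem_svlPromise_iff`, `IsSvlLine.svlSinkBit_eq`, `Equiv.swap`. -/
theorem stub_sinkFlipCoupling :
    ∀ (m T : ℕ), 1 ≤ T → 2 * (T + 1) ≤ 2 ^ m →
      ∃ (J : Finset (SVLInput m T)) (φ : SVLInput m T → SVLInput m T),
        J.Nonempty ∧ J ⊆ mergeFreeSet m T ∧ (mergeFreeSet m T).card ≤ 64 * J.card ∧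
        ∀ t ∈ J, φ t ∈ J ∧ φ (φ t) = t ∧ svlSinkBit m T (φ t) ≠ svlSinkBit m T t ∧
          ∀ xs : Fin (T + 1) → Fin (2 ^ m), IsSvlLine t xs →
            ∀ h : ℕ, h < T → ∀ k : Fin (2 ^ m * m + 2 ^ m * (T + 1)),
              horizonInput h t k ≠ horizonInput h (φ t) k →
                ∃ jb : Fin m, k = svlSuccIndex m T (xs (Fin.last T)) jb ∨
                  k = svlSuccIndex m T (xs ⟨T - 1, by omega⟩) jb ∨
                  k = svlSuccIndex m T (flipLow (xs (Fin.last T))) jb := by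
  sorry

/-- **K3 — `stub_horizonAssembly`: the HORIZON HYBRID + SINK-FLIP ASSEMBLY (elementary, BBBV-type).**
K1 → K2 → K4 → there is `c₁ > 0` such that no algorithm with `q + 3 ≤ T` and `q ≤ c₁ √(2^m)`
bit-queries computes the sink bit with error `1/3` on all of `J′` (`2(T+1) ≤ 2^m`).
Proof plan (card K3/P1/P2, all with `QueryHybridBound.lean` tools):
(i) time-indexed telescoping (20-line generalisation of `l2Norm'_stateAt_sub_le_sum` to
`stateAtSched`, plus `abs_acceptProb_sub_le` for arbitrary unit final states): for every `t`,
`‖stateAt A t q − horizonState A t q‖ ≤ Σ_{r<q} ‖(O_t − O_{hor_r t}) H_r(t)‖ ≤ Σ_r 2√(qM_r(t))`,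
`hor_r t = horizonInput (r+2) t = flipBlock t {cells (x_i,i) : i ≥ r+3}` (`l2Norm'_oracle_sub_le`);
(ii) average over `J′`, Cauchy–Schwarz `avg √· ≤ √avg ·`, and K2 applied to the truncation `A_r`
(same unitaries `0..r`, `queries := r`, `horizonState A_r t r = horizonState A t r`) with `out` = the
`V`-cell addressed by the query register: `avg_t ‖real − horizon‖ ≤ 2q √(K₂/2^m)`;
(iii) K4 gives `J ⊆ J′`, `|J′| ≤ 64|J|`, involution `φ` flipping the sink bit with horizon inputs
differing only in rows `x_{T-1}, x_T, x_T ⊕ 1`; telescoping between the two HORIZON runs and K1 (for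
`A_r` with `out` = row of the query register, resp. `flipLow` of it; levels `T-1, T ≥ r+3` since
`q+3 ≤ T`; sums over `J` by Cauchy–Schwarz and nonnegativity:
`Σ_{t∈J} √a_t ≤ √(|J| Σ_{t∈J′} a_t) ≤ √(64)|J| √(avg_{J′} a) ≤ 8|J|√(K/2^m)`):
`Σ_{t∈J} ‖H_q(t) − H_q(φ t)‖ ≤ 2·3·8·q|J| √(K₁/2^m)`, and likewise in (ii)
`Σ_{t∈J} ‖real − horizon‖(t) ≤ 2·8·q|J| √(K₂/2^m)`;
(iv) correctness on `t, φ t ∈ J ⊆ J′` with opposite sink bits forces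
`1/3 ≤ |P(t) − P(φ t)| ≤ 2‖real−hor‖(t) + 2‖H_q t − H_q (φ t)‖ + 2‖real−hor‖(φ t)`; summing over
`t ∈ J` (φ is a bijection of `J`): `|J|/3 ≤ (64√K₂ + 96√K₁)·q|J|/√N`, impossible for
`q ≤ c₁√N`, `c₁ := min c₀ c₀' (1/(4·(64√K₂ + 96√K₁)))`. `J ≠ ∅` by K4.
Why it might fail: bookkeeping only (it is exactly the card's elementary shell; every smallness is
imported from K1/K2). Size: L. Leans on: `l2Norm'_*`, `queryMagnitude`, `sum_norm_sq_oracle_sub_le`,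
`l2Norm'_oracle_sub_le`, `flipBlock`, `Real.sum_sqrt_mul_sqrt_le` / `Real.sqrt_le_sqrt`. -/
theorem stub_horizonAssembly
    (hK1 : ∃ K c₀ : ℝ, 0 < K ∧ 0 < c₀ ∧
      ∀ (m T j : ℕ) (hj : j ≤ T) (A : QQueryAlg (2 ^ m * m + 2 ^ m * (T + 1)))
        (out : Fin (2 ^ m * m + 2 ^ m * (T + 1)) × Bool × A.W → Fin (2 ^ m)),
        2 * (T + 1) ≤ 2 ^ m → A.queries + 3 ≤ j → (A.queries : ℝ) ≤ c₀ * Real.sqrt (2 ^ m) →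
        (∑ t ∈ mergeFreeSet m T, ∑ b : Fin (2 ^ m * m + 2 ^ m * (T + 1)) × Bool × A.W,
            if ∃ xs : Fin (T + 1) → Fin (2 ^ m), IsSvlLine t xs ∧ out b = xs ⟨j, Nat.lt_succ_of_le hj⟩
            then ‖horizonState A t A.queries b‖ ^ 2 else 0) /
          ((mergeFreeSet m T).card : ℝ) ≤ K / 2 ^ m)
    (hK2 : ∃ K c₀ : ℝ, 0 < K ∧ 0 < c₀ ∧
      ∀ (m T : ℕ) (A : QQueryAlg (2 ^ m * m + 2 ^ m * (T + 1)))
        (out : Fin (2 ^ m * m + 2 ^ m * (T + 1)) × Bool × A.W → Fin (2 ^ m) × Fin (T + 1)),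
        2 * (T + 1) ≤ 2 ^ m → (A.queries : ℝ) ≤ c₀ * Real.sqrt (2 ^ m) →
        (∑ t ∈ mergeFreeSet m T, ∑ b : Fin (2 ^ m * m + 2 ^ m * (T + 1)) × Bool × A.W,
            if A.queries + 3 ≤ ((out b).2 : ℕ) ∧
                ∃ xs : Fin (T + 1) → Fin (2 ^ m), IsSvlLine t xs ∧ (out b).1 = xs (out b).2
            then ‖horizonState A t A.queries b‖ ^ 2 else 0) /
          ((mergeFreeSet m T).card : ℝ) ≤ K / 2 ^ m)
    (hK4 : ∀ (m T : ℕ), 1 ≤ T → 2 * (T + 1) ≤ 2 ^ m →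
      ∃ (J : Finset (SVLInput m T)) (φ : SVLInput m T → SVLInput m T),
        J.Nonempty ∧ J ⊆ mergeFreeSet m T ∧ (mergeFreeSet m T).card ≤ 64 * J.card ∧
        ∀ t ∈ J, φ t ∈ J ∧ φ (φ t) = t ∧ svlSinkBit m T (φ t) ≠ svlSinkBit m T t ∧
          ∀ xs : Fin (T + 1) → Fin (2 ^ m), IsSvlLine t xs →
            ∀ h : ℕ, h < T → ∀ k : Fin (2 ^ m * m + 2 ^ m * (T + 1)),
              horizonInput h t k ≠ horizonInput h (φ t) k →
                ∃ jb : Fin m, k = svlSuccIndex m T (xs (Fin.last T)) jb ∨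
                  k = svlSuccIndex m T (xs ⟨T - 1, by omega⟩) jb ∨
                  k = svlSuccIndex m T (flipLow (xs (Fin.last T))) jb) :
    ∃ c₁ : ℝ, 0 < c₁ ∧ ∀ (m T : ℕ) (A : QQueryAlg (2 ^ m * m + 2 ^ m * (T + 1))),
      2 * (T + 1) ≤ 2 ^ m → A.queries + 3 ≤ T → (A.queries : ℝ) ≤ c₁ * Real.sqrt (2 ^ m) →
      ¬ A.ComputesWithError (1 / 3) (↑(mergeFreeSet m T)) (svlSinkBit m T) := by
  sorry

/-! ## §3 The composition (kernel-checked; no `sorry` of its own) -/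

/-- **The crux from the four stubs.** `c := min c₁ (1/4)`. Fix admissible `m, T` (so
`2(T+1) ≤ 2^m`) and an optimal algorithm `A` for the sink bit on `svlPromise ⊇ J′`
(`exists_queries_eq_quantumQueryComplexityOn`) with `Q` queries. K3 (fed K1, K2, K4) forbids
`Q + 3 ≤ T ∧ Q ≤ c₁ √(2^m)`, so `Q ≥ T - 2` or `Q > c₁ √(2^m)`; together with `Q ≥ 1` (§1):
if `Q > c₁√N` then `c·min ≤ c√N ≤ c₁√N < Q`; if `Q ≥ T-2` and `T ≥ 3` then
`c·min ≤ (T+1)/4 ≤ T-2 ≤ Q`; if `T ≤ 2` then `c·min ≤ 3/4 ≤ 1 ≤ Q`. Dividing by `m ≥ 2` only helps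
(the line proves the crux without its `1/m`). -/
theorem WbwVerifiableLineNoSpeedup_of : WbwVerifiableLineNoSpeedup := by
  obtain ⟨c₁, hc₁, hH⟩ :=
    stub_horizonAssembly stub_deepGuessing stub_pairGuessing stub_sinkFlipCoupling
  rw [crux_iff]
  refine ⟨min c₁ (1 / 4), by positivity, fun m T hm hT hTm => ?_⟩
  set c : ℝ := min c₁ (1 / 4) with hc
  have hcc₁ : c ≤ c₁ := min_le_left _ _
  have hc4 : c ≤ 1 / 4 := min_le_right _ _
  have hcpos : 0 < c := by positivity
  have hmR : (2 : ℝ) ≤ m := by exact_mod_cast hm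
  have hQ1 : (1 : ℝ) ≤ (svlQ m T : ℝ) := by exact_mod_cast one_le_svlQ_of_hyps hT hTm
  have h2T : 2 * (T + 1) ≤ 2 ^ m := by
    have h2 : 2 ^ m = 2 * 2 ^ (m - 1) := by
      rw [← Nat.pow_succ']
      congr 1
      omega
    omega
  -- an optimal algorithm on the promise, restricted to the merge-free instances
  obtain ⟨A, hAq, hA⟩ := exists_queries_eq_quantumQueryComplexityOn
    (by norm_num : (0 : ℝ) ≤ 1 / 3) (svlPromise m T) (svlSinkBit m T)
  have hA' : A.ComputesWithError (1 / 3) (↑(mergeFreeSet m T)) (svlSinkBit m T) :=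
    hA.mono le_rfl mergeFreeSet_subset_svlPromise
  have hAq' : A.queries = svlQ m T := hAq
  -- K3: either many queries relative to T (walk branch) or relative to √N (Grover branch)
  have hdich : (T : ℝ) - 2 ≤ (svlQ m T : ℝ) ∨ c₁ * Real.sqrt (2 ^ m) < (svlQ m T : ℝ) := by
    by_contra hcon
    push Not at hcon
    obtain ⟨h1, h2⟩ := hcon
    have hlt : (svlQ m T : ℝ) + 2 < (T : ℝ) := by linarith
    have hlt' : svlQ m T + 2 < T := by exact_mod_cast hlt
    have hq3 : A.queries + 3 ≤ T := by omega
    have h2' : (A.queries : ℝ) ≤ c₁ * Real.sqrt (2 ^ m) := by rw [hAq']; exact h2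
    exact hH m T A h2T hq3 h2' hA'
  -- dividing by `m ≥ 2` only weakens the bound
  have hdiv : c * min ((T : ℝ) + 1) (Real.sqrt (2 ^ m)) / m ≤
      c * min ((T : ℝ) + 1) (Real.sqrt (2 ^ m)) := by
    rw [div_le_iff₀ (by linarith)]
    have h0 : 0 ≤ c * min ((T : ℝ) + 1) (Real.sqrt (2 ^ m)) := by positivity
    nlinarith
  refine hdiv.trans ?_
  rcases hdich with hwalk | hgrover
  · by_cases hT3 : 3 ≤ T
    · -- walk branch, `T ≥ 3`: `c (T+1) ≤ (T+1)/4 ≤ T - 2 ≤ Q`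
      have hT3R : (3 : ℝ) ≤ T := by exact_mod_cast hT3
      calc c * min ((T : ℝ) + 1) (Real.sqrt (2 ^ m))
          ≤ (1 / 4) * ((T : ℝ) + 1) :=
            mul_le_mul hc4 (min_le_left _ _) (by positivity) (by norm_num)
        _ ≤ (T : ℝ) - 2 := by linarith
        _ ≤ _ := hwalk
    · -- `T ∈ {1, 2}`: `c · 3 ≤ 3/4 ≤ 1 ≤ Q`
      push Not at hT3
      have hT2R : (T : ℝ) + 1 ≤ 3 := by exact_mod_cast (show T + 1 ≤ 3 by omega)
      calc c * min ((T : ℝ) + 1) (Real.sqrt (2 ^ m))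
          ≤ (1 / 4) * 3 :=
            mul_le_mul hc4 ((min_le_left _ _).trans hT2R) (by positivity) (by norm_num)
        _ ≤ 1 := by norm_num
        _ ≤ _ := hQ1
  · -- Grover branch: `c √N ≤ c₁ √N < Q`
    calc c * min ((T : ℝ) + 1) (Real.sqrt (2 ^ m))
        ≤ c₁ * Real.sqrt (2 ^ m) :=
          mul_le_mul hcc₁ (min_le_right _ _) (by positivity) hc₁.le
      _ ≤ _ := hgrover.le

end Summit.QuantumAdvantage.QuantumAdvantage.Cruxes.WbwVerifiableLineNoSpeedup.TranspositionCouplingReduction
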